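import Summits.Langlands.Langlands.Theses.SplitPrimeInduction

/-!
# Disproof of `TorsionLeviInduction` — findings (birth vetting, refuter crux-attack, 2026-08-17)

Crux `stmt-Langlands-16942` = `Summit.Langlands.Langlands.Theses.SplitPrimeInduction.TorsionLeviInduction`.
NO KILL.  What this work file certifies / records:

* `torsionLeviInduction_hypothesis_satisfiable` (checked, std axioms): the occurrence hypothesis
  `∃ c ≠ 0, ∀ v ∉ S, ∀ j, T^{(j)}_v c = a v j • c` holds for EVERY `F, n, S, K, ϖ, k` with `i = 0`,
  `c =` the constant class `𝟙 ∈ H⁰(X_K, k) = Fun(Γ\𝒢/K, k)` and `a v j = heckeDegree …`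
  (`#(K t K / K)` in `k`, junk `0` if infinite).  So the crux is nowhere vacuous: at every parameter
  it asserts the existence of the INDUCED eigenclass over `ℚ` (for the constant class: the mod-`p`
  system of `⊕_{i=1}^{n} Ind_F^ℚ(𝟙) ⊗ χ_cyc^{-i}`, an Eisenstein-type system of `GL_{n[F:ℚ]}/ℚ`).
* LOAD-BEARING HYPOTHESIS (paper proof, Lean near-miss `torsionLeviInduction_false_without_parity`):
  dropping `(Even n ∨ r₁(F) ≤ 1)` makes the statement FALSE.  Witness: `F` real quadratic (e.g. `ℚ(√2)`,
  `p = 7`, or `ℚ(√5)`, `p = 11`), `n = 1`, `S = ∅`, `K = GL₁(𝒪̂_F)`, `k = 𝔽_p`, the constant class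
  (`a w 1 = 1`).  MECHANISM (model-specific central-character parity): in
  `H^*(GL_m(ℚ), Fun(GL_m(𝔸_f)/K', k))` the rational central elements `r·1 ∈ GL_m(ℚ)` act trivially
  (inner automorphisms act trivially on group cohomology); decomposing `ι(r)` for a prime
  `r = ℓ ≡ −1 (mod N)` (`N` the `S'`-level of the open `K'`, Dirichlet) and using that `(−1)_{S'}`
  acts trivially (`ι(−1)` does, and `(−1)^{S'} ∈ ∏_{v∉S'} GL_m(ℤ_v) ≤ K'`) gives `b_{ℓ,m} = 1` in `k`
  for every eigenclass; i.e. `ℓ ↦ b_{ℓ,m}` is an EVEN character `β̃` of `(ℤ/N)^×`.  The induced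
  identity forces `ℓ^{m(m+1)/2} b_{ℓ,m} = det(Ind σ)(Frob_ℓ^{geom})`, so `det(Ind σ)·χ^{m(m+1)/2}` must
  be even.  For the real-quadratic witness (`m = 2`): `ℓ ≡ −1 (mod 8N·p)` is SPLIT (`ε_F(−1) = +1`),
  the identity at `ℓ` reads `1 − ℓ b₁X + ℓ³ b₂ X² = (1 − ℓX)²`, so `b_{ℓ,2} = ℓ⁻¹ = −1 ≠ 1` in `𝔽_p`
  (`p` odd): contradiction.  For imaginary quadratic `F` the same `ℓ` is INERT, `b_{ℓ,2} = −ℓ⁻¹ = 1`: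
  consistent.  General bookkeeping: `n` even ⇒ always consistent; `n` odd ⇒ consistent iff
  `r₁(F) ≡ 0, 1 (mod 4)`; the crux keeps `r₁ ≤ 1` (the finer signed oddness `tr (Ind σ)(c) = −1`
  excludes `r₁ ≥ 4`).  OBSTRUCTION to closing the near-miss in Lean (not attempted this cycle):
  (i) "central/inner automorphism acts trivially on `groupCohomology` in every degree" is not in
  Mathlib; (ii) unpacking `IsOpen K'` in `GL_m(𝔸_{ℚ,f})` to a principal congruence level at `S'`;
  (iii) certified prime splitting in a concrete real quadratic field at `p` and at a Dirichlet prime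
  `ℓ ≡ −1 (mod 8Np)` (Kummer–Dedekind with the new `Ideal.inertiaDeg`/`ramificationIdx`);
  (iv) coefficient extraction from the `finprod` over the fibre.
* CHEAP ATTACKS THAT FAILED (Scratch.lean, 400k heartbeats each): `simp`/`aesop`/`exact?` on the crux,
  on `¬crux`, on `crux → Langlands`, on `Langlands → crux` — all time out / fail; the summit is
  characteristic-0 reciprocity (`ReciprocityData`, ℓ-adic), logically unrelated to a mod-`p` transfer.
* DEGENERATE CASES (paper): `F = ℚ` true by `b := a` up to `Fin (n*1) ≃ Fin n`; `v = p` both sides of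
  the identity collapse to `1`; ramified `v` and `p` go into the existential `S'`; `k` not algebraically
  closed is harmless (eigenvalues off `S' ∪ {p}` are `k`-rational from the identity; eigenspaces commute
  with base change); `n = 1`, `F` imaginary quadratic, constant class: target = mod-`p` system of
  `E₂(ε_F, ω⁻¹)`/`E₂(1, ε_Fω⁻¹)` (level `|d_F|p`), visible in the model
  (`H^*(model) = H^*(Sh)^{c=+1}`, boundary lines carry Galois characters `1` (even) and `ε_F`);
  `p = 2`: target ≡ trivial `H⁰` system.  `n = 1, d ≥ 3` and `n ≥ 2`: generalised Serre for induced
  representations over `ℚ` — open; no finite certified falsifier (absence at ALL levels is not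
  finitely checkable).
-/

noncomputable section

set_option linter.dupNamespace false

open CategoryTheory

namespace Summit.Langlands.Langlands.Cruxes.TorsionLeviInduction.Disproof

open Literature.NumberTheory.Automorphic Literature.NumberTheory.Automorphic.ArithmeticQuotient

universe u

variable (k : Type u) [CommRing k] {Γ 𝒢 : Type u} [Group Γ] [Group 𝒢]
  (ι : Γ →* 𝒢) (L : Subgroup 𝒢)

/-- The constant function `1` on `𝒢 ⧸ L`, as a `Γ`-invariant of `Fun(𝒢 ⧸ L, k)`. [folklore] -/
def constInvariant : (coeffRepresentation k ι L k).invariants :=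
  ⟨fun _ => 1, fun γ => by ext c; simp⟩

@[simp]
theorem constInvariant_val : ((constInvariant k ι L : (coeffRepresentation k ι L k).invariants) :
    (𝒢 ⧸ L) → k) = fun _ => 1 := rfl

open scoped Classical in
/-- The degree of `[L g L]` in `k`: `#(L g L / L)`, junk `0` if infinite. [folklore] -/
def heckeDegree (g : 𝒢) : k :=
  if h : (doubleCosetQuot L g).Finite then (h.toFinset.card : k) else 0

/-- `[L g L]` acts on the constant function `1` by the scalar `heckeDegree`. [folklore] -/
theorem heckeFun_const (g : 𝒢) :
    heckeFun k L g k (fun _ => (1 : k)) = heckeDegree k L g • (fun _ => (1 : k)) := by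
  classical
  ext c
  rw [heckeFun_apply]
  unfold heckeDegree
  split_ifs with h
  · simp
  · simp

/-- The invariants functor applied to the Hecke endomorphism sends the constant invariant to
`heckeDegree •` itself. [folklore] -/
theorem invariantsFunctor_map_heckeRepHom_const (g : 𝒢) :
    (Rep.invariantsFunctor k Γ).map (heckeRepHom k L g k ι) (constInvariant k ι L) =
      heckeDegree k L g • constInvariant k ι L := by
  apply Subtype.ext
  change (heckeRepHom k L g k ι).hom (fun _ => (1 : k)) = heckeDegree k L g • (fun _ => (1 : k))
  rw [heckeRepHom_hom_apply, heckeFun_const]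

/-- **The constant class** `𝟙 ∈ H⁰(X_L, k)`. [folklore] -/
def constClass : cohomology k ι L k 0 :=
  (groupCohomology.H0Iso (coeffRep k ι L k)).inv (constInvariant k ι L)

/-- The constant class is non-zero as soon as `k` is nontrivial. [folklore] -/
theorem constClass_ne_zero [Nontrivial k] : constClass k ι L ≠ 0 := by
  intro h
  have h1 : (groupCohomology.H0Iso (coeffRep k ι L k)).hom (constClass k ι L) =
      constInvariant k ι L := by
    simp [constClass]
  rw [h, map_zero] at h1
  have h2 := congrArg (fun f : (coeffRepresentation k ι L k).invariants => (f : (𝒢 ⧸ L) → k)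
    ((1 : 𝒢) : 𝒢 ⧸ L)) h1
  simp at h2

/-- The constant class is an eigenvector of every Hecke operator `T_g` on `H⁰`, with eigenvalue
`heckeDegree k L g`. [folklore] -/
theorem heckeEnd_constClass (g : 𝒢) :
    heckeEnd k L g k ι 0 (constClass k ι L) = heckeDegree k L g • constClass k ι L := by
  have hT : groupCohomology.map (MonoidHom.id Γ) (heckeRepHom k L g k ι) 0 =
      (groupCohomology.H0Iso (coeffRep k ι L k)).hom ≫
        (Rep.invariantsFunctor k Γ).map (heckeRepHom k L g k ι) ≫
          (groupCohomology.H0Iso (coeffRep k ι L k)).inv := by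
    rw [← Category.assoc, ← groupCohomology.map_id_comp_H0Iso_hom, Category.assoc,
      Iso.hom_inv_id, Category.comp_id]
  have h1 : (groupCohomology.H0Iso (coeffRep k ι L k)).hom (constClass k ι L) =
      constInvariant k ι L := by
    simp [constClass]
  have h2 := ConcreteCategory.congr_hom hT (constClass k ι L)
  rw [CategoryTheory.comp_apply, CategoryTheory.comp_apply, h1,
    invariantsFunctor_map_heckeRepHom_const, map_smul] at h2
  exact h2

/-- **Non-vacuity of the occurrence hypothesis.** For every level `L`, every `ι` and every family of
Hecke elements, degree `0` carries a non-zero simultaneous eigenclass (the constant class), with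
eigenvalues the degrees. In particular the hypothesis `∃ c ≠ 0, ∀ v ∉ S, ∀ j, T^{(j)}_v c = a v j • c`
of `TorsionLeviInduction` holds with `i = 0`, `a v j = heckeDegree …`. [folklore] -/
theorem exists_eigenclass_degree_zero [Nontrivial k] {V : Type*} (t : V → ℕ → 𝒢) :
    ∃ c : cohomology k ι L k 0, c ≠ 0 ∧
      ∀ v j, heckeEnd k L (t v j) k ι 0 c = heckeDegree k L (t v j) • c :=
  ⟨constClass k ι L, constClass_ne_zero k ι L, fun v j => heckeEnd_constClass k ι L (t v j)⟩


/-! ## The occurrence hypothesis of the crux, instantiated (GL_n over a number field) -/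

section Crux

open IsDedekindDomain NumberField

/-- **The occurrence hypothesis of `SplitPrimeInduction.TorsionLeviInduction` is satisfiable for
every `F, n, S, K, ϖ` and every field `k`** (no use of `p`, of the level shape or of the
uniformiser normalisation): `i = 0`, `a v j = heckeDegree …`, `c =` the constant class.
Hence the crux is not vacuously true; its content is the existence of the INDUCED eigenclass
over `ℚ`. [folklore] -/
theorem torsionLeviInduction_hypothesis_satisfiable (F : Type) [Field F] [NumberField F] (n : ℕ)
    (S : Finset (HeightOneSpectrum (𝓞 F))) (K : Subgroup (GL (Fin n) (FiniteAdeleRing (𝓞 F) F)))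
    (ϖ : ∀ v : HeightOneSpectrum (𝓞 F), (v.adicCompletion F)ˣ) (k : Type) [Field k] :
    ∃ (i : ℕ) (a : HeightOneSpectrum (𝓞 F) → ℕ → k),
      ∃ c : ArithmeticQuotient.cohomology k
          (Matrix.GeneralLinearGroup.map (algebraMap F (FiniteAdeleRing (𝓞 F) F))) K k i,
        c ≠ 0 ∧ ∀ v ∉ S, ∀ j : ℕ, 1 ≤ j → j ≤ n →
          ArithmeticQuotient.heckeEnd k K (GLn.sndHom n F (heckeDiagAt n F v (ϖ v) j)) k
            (Matrix.GeneralLinearGroup.map (algebraMap F (FiniteAdeleRing (𝓞 F) F))) i c = a v j • c := by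
  refine ⟨0, fun v j => heckeDegree k K (GLn.sndHom n F (heckeDiagAt n F v (ϖ v) j)),
    constClass k _ K, constClass_ne_zero k _ K, fun v _ j _ _ => ?_⟩
  exact heckeEnd_constClass k _ K _

end Crux


/-! ## Load-bearing analysis: the parity hypothesis -/

section Parity

open Literature.NumberTheory.Automorphic Literature.NumberTheory.GaloisRepresentations
  IsDedekindDomain NumberField Polynomial

/-- The crux with its parity hypothesis `(Even n ∨ InfinitePlace.nrRealPlaces F ≤ 1)` DROPPED
(everything else verbatim). [folklore] -/
def TorsionLeviInductionWithoutParity : Prop :=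
  ∀ (F : Type) [Field F] [NumberField F] (n : ℕ), 1 ≤ n → ∀ (p : ℕ) [Fact p.Prime], (∀ v : HeightOneSpectrum (𝓞 F), ((p : ℕ) : 𝓞 F) ∈ v.asIdeal → v.asIdeal.ramificationIdx ℤ = 1 ∧ v.asIdeal.inertiaDeg ℤ = 1) → ∀ (S : Finset (HeightOneSpectrum (𝓞 F))) (K : Subgroup (GL (Fin n) (FiniteAdeleRing (𝓞 F) F))) (ϖ : ∀ v : HeightOneSpectrum (𝓞 F), (v.adicCompletion F)ˣ), (∀ v, Valued.v ((ϖ v : (v.adicCompletion F)ˣ) : v.adicCompletion F) = WithZero.exp (-1 : ℤ)) → IsOpen (K : Set (GL (Fin n) (FiniteAdeleRing (𝓞 F) F))) → K ≤ glFiniteIntegralLevel n F → (∀ g ∈ glFiniteIntegralLevel n F, (∀ v ∈ S, ∀ i j : Fin n, ((g : Matrix (Fin n) (Fin n) (FiniteAdeleRing (𝓞 F) F)) i j) v = (1 : Matrix (Fin n) (Fin n) (v.adicCompletion F)) i j) → g ∈ K) → ∀ (k : Type) [Field k] [CharP k p] (i : ℕ) (a : HeightOneSpectrum (𝓞 F)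 → ℕ → k), (∃ c : ArithmeticQuotient.cohomology k (Matrix.GeneralLinearGroup.map (algebraMap F (FiniteAdeleRing (𝓞 F) F))) K k i, c ≠ 0 ∧ ∀ v ∉ S, ∀ j : ℕ, 1 ≤ j → j ≤ n → ArithmeticQuotient.heckeEnd k K (GLn.sndHom n F (heckeDiagAt n F v (ϖ v) j)) k (Matrix.GeneralLinearGroup.map (algebraMap F (FiniteAdeleRing (𝓞 F) F))) i c = a v j • c) → ∃ (S' : Finset (HeightOneSpectrum (𝓞 ℚ))) (K' : Subgroup (GL (Fin (n * Module.finrank ℚ F)) (FiniteAdeleRing (𝓞 ℚ) ℚ))) (ϖ' : ∀ v : HeightOneSpectrum (𝓞 ℚ), (v.adicCompletion ℚ)ˣ) (i' : ℕ) (b : HeightOneSpectrum (𝓞 ℚ) → ℕ → k), (∀ v, Valued.v ((ϖ' v : (v.adicCompletion ℚ)ˣ) : v.adicCompletion ℚ) = WithZero.exp (-1 : ℤ)) ∧ IsOpen (K' : Set (GL (Fin (n * Module.finrank ℚ F)) (FiniteAdeleRing (𝓞 ℚ) ℚ))) ∧ K' ≤ glFiniteIntegralLevel (n * Module.finrank ℚ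 F) ℚ ∧ (∀ g ∈ glFiniteIntegralLevel (n * Module.finrank ℚ F) ℚ, (∀ v ∈ S', ∀ i j : Fin (n * Module.finrank ℚ F), ((g : Matrix (Fin (n * Module.finrank ℚ F)) (Fin (n * Module.finrank ℚ F)) (FiniteAdeleRing (𝓞 ℚ) ℚ)) i j) v = (1 : Matrix (Fin (n * Module.finrank ℚ F)) (Fin (n * Module.finrank ℚ F)) (v.adicCompletion ℚ)) i j) → g ∈ K') ∧ (∃ c : ArithmeticQuotient.cohomology k (Matrix.GeneralLinearGroup.map (algebraMap ℚ (FiniteAdeleRing (𝓞 ℚ) ℚ))) K' k i', c ≠ 0 ∧ ∀ v ∉ S', ∀ j : ℕ, 1 ≤ j → j ≤ n * Module.finrank ℚ F → ArithmeticQuotient.heckeEnd k K' (GLn.sndHom (n * Module.finrank ℚ F) ℚ (heckeDiagAt (n * Module.finrank ℚ F) ℚ v (ϖ' v) j)) k (Matrix.GeneralLinearGroup.map (algebraMap ℚ (FiniteAdeleRing (𝓞 ℚ) ℚ))) i' c = b v j • c) ∧ ∀ v : HeightOneSpectrum (𝓞 ℚ), v ∉ S' → (∀ w : HeightOneSpectrum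 (𝓞 F), w.asIdeal.under (𝓞 ℚ) = v.asIdeal → w ∉ S) ∧ (1 + ∑ j ∈ Finset.Icc 1 (n * Module.finrank ℚ F), C ((-1 : k) ^ j * (v.residueCard : k) ^ (j * (j + 1) / 2) * b v j) * X ^ j : Polynomial k) = ∏ᶠ w ∈ {w : HeightOneSpectrum (𝓞 F) | w.asIdeal.under (𝓞 ℚ) = v.asIdeal}, (1 + ∑ j ∈ Finset.Icc 1 n, C ((-1 : k) ^ j * (w.residueCard : k) ^ (j * (j + 1) / 2) * a w j) * X ^ j : Polynomial k).comp (X ^ w.asIdeal.inertiaDeg (𝓞 ℚ))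

/-- Dropping a hypothesis strengthens the statement (sanity check of the retyping). [folklore] -/
theorem torsionLeviInduction_of_withoutParity (h : TorsionLeviInductionWithoutParity) :
    Summit.Langlands.Langlands.Theses.SplitPrimeInduction.TorsionLeviInduction := by
  intro F _ _ n hn _hpar p _ hsplit S K ϖ hϖ hKo hKi hKS k _ _ i a ha
  exact h F n hn p hsplit S K ϖ hϖ hKo hKi hKS k i a ha

/-- **NEAR-MISS (paper proof in the module docstring; not closed in Lean this cycle).**
`¬ TorsionLeviInductionWithoutParity`: witness `F = ℚ(√2)`, `n = 1`, `p = 7` (split), `S = ∅`,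
`K = glFiniteIntegralLevel 1 F`, `k = ZMod 7`, `i = 0`, the constant class
(`torsionLeviInduction_hypothesis_satisfiable`), and a Dirichlet prime `ℓ ≡ −1 (mod 56·N)` where
`N` is the `S'`-level of the adversary's open `K'`: the identity at the split prime `ℓ` gives
`b_{ℓ,2} = ℓ⁻¹ = −1` in `𝔽₇`, while triviality of `ι(ℓ)`, `ι(−1)` (central rational elements) on
group cohomology and `(−ℓ)_{S'} ∈ K'` give `b_{ℓ,2} = 1`.  Obstructions (i)–(iv) listed in the
module docstring. [folklore] -/
theorem torsionLeviInduction_false_without_parity : ¬ TorsionLeviInductionWithoutParity := by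
  sorry

end Parity

end Summit.Langlands.Langlands.Cruxes.TorsionLeviInduction.Disproof
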